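import Summits.HodgeConjecture.HodgeConjecture.Theorems.PadicSemiregularLiftHodgeBeyondAnchorsSectionPullback
import Literature.AlgebraicGeometry.HodgeTheory.HodgeTypePullback
import Literature.AlgebraicGeometry.HodgeTheory.ComplexConjugation
import Literature.NumberTheory.Transcendental.AnalytificationProjProofs

/-!
# The Hodge conjecture descends along `X × C → X` (`C` a curve): `HC(X × ℙ¹) ⇒ HC(X)`

Route `PadicSemiregularLift` of `HodgeConjecture`, support item `HodgeBeyondAnchors`
(stmt-HodgeConjecture-14054); second helper file of the product trick (consumer:
`…HodgeBeyondAnchorsEquivalence`).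

* `hodgeConjectureFor_of_tensor` — for `X` smooth projective of dimension `n`, `C` a smooth
  projective curve with infinitely many complex points, a Hodge model of `X`, and the tree's named
  fact `hodgePQ_independent_of_hodgeModel` (so that `pr_X^*` preserves Hodge types,
  `IsOfHodgeType.map_of_independent`; `dim (X ⊗ C) > dim X`):
  `HodgeConjectureFor (n + 1) (X ⊗ C) → HodgeConjectureFor n X`. A rational `(p, p)`-class `c` on
  `X` pulls back to a rational `(p, p)`-class on `X ⊗ C`, algebraic by hypothesis, and a general
  slice `i_t^* pr_X^* c = c` of an algebraic class is algebraic (first helper file,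
  `exists_sliceAt_map_mem_algebraicClasses`);
* `hodgeConjectureFor_of_tensor_tensor` — the same twice, for `(X ⊗ C) ⊗ C`;
* `infinite_complexPoints_projectiveSpace_one`, `exists_pt_notMem` — `ℙ¹(ℂ)` is infinite, and
  complex points avoid any finite set of scheme points (`Motives.ComplexPoints.ext_of_pt_eq`).

References: W. Fulton, *Intersection Theory* (1998), §10.1, Example 10.1.2; C. Voisin, *Hodge
Theory and Complex Algebraic Geometry I* (2002), §7.3.2, §11.3; R. Hartshorne, *Algebraic
Geometry* (1977), II Ex. 2.14.
-/

set_option linter.dupNamespace false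

noncomputable section

open CategoryTheory AlgebraicGeometry MonoidalCategory CartesianMonoidalCategory Topology
open Literature.AlgebraicTopology.SingularHomology
open Literature.AlgebraicGeometry Literature.AlgebraicGeometry.HodgeTheory
  Literature.AlgebraicGeometry.Motives

namespace Summit.HodgeConjecture.HodgeConjecture.Theorems.HodgeBeyondAnchors

/-! ## Points of the auxiliary curve -/

section Points

variable {n : ℕ} {C : SchemeOver ℂ}

/-- **A curve with infinitely many complex points has complex points off any finite set of scheme
points** (complex points of a `ℂ`-scheme locally of finite type are determined by their underlying
closed point, the tree's `Motives.ComplexPoints.ext_of_pt_eq`). [folklore] -/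
theorem exists_pt_notMem (hC : IsSmoothProjective n C) [Infinite (ComplexPoints C)]
    (F : Set C.left) (hF : F.Finite) : ∃ t : ComplexPoints C, t.pt ∉ F := by
  haveI := hC.smoothOfRelativeDimension
  haveI : Smooth C.hom := SmoothOfRelativeDimension.smooth n C.hom
  have hinj : Function.Injective (fun t : ComplexPoints C ↦ t.pt) :=
    fun P Q h ↦ Motives.ComplexPoints.ext_of_pt_eq h
  by_contra hcon
  push Not at hcon
  exact Set.infinite_univ ((hF.preimage hinj.injOn).subset fun t _ ↦ hcon t)

open Literature.NumberTheory.Transcendental in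
/-- `ℙ¹(ℂ)` is infinite: `a ↦ [a : 1]` is injective (the tree's `projPoint_injective`).
[cite: Hartshorne1977, II Ex. 2.14] -/
theorem infinite_complexPoints_projectiveSpace_one :
    Infinite (ComplexPoints (projectiveSpace 1 ℂ)) := by
  have hinj : Function.Injective
      fun a : ℂ ↦ projPoint 1 (Projectivization.mk ℂ ![a, 1] (by simp)) := by
    intro a b hab
    have := projPoint_injective 1 hab
    rw [Projectivization.mk_eq_mk_iff] at this
    obtain ⟨u, hu⟩ := this
    have h1 := congr_fun hu 1
    have h0 := congr_fun hu 0
    simp only [Pi.smul_apply, Matrix.cons_val_one, Matrix.cons_val_zero,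
      Matrix.cons_val_fin_one, Units.smul_def, smul_eq_mul, mul_one] at h0 h1
    rw [h1, one_mul] at h0
    exact h0.symm
  exact Infinite.of_injective _ hinj

end Points

/-! ## Descent of the Hodge conjecture along `X × C → X` -/

section Descent

variable {n : ℕ} {X C : SchemeOver ℂ}

/-- `i_t^* ∘ pr_X^* = id` on `H^k(X(ℂ); ℂ)` (`i_t ≫ pr_X = 𝟙`). [cite: Fulton1998, §10.1] -/
theorem complexBetti_map_sliceAt_map_fst (t : ComplexPoints C) (k : ℕ) (c : complexBetti X k) :
    complexBetti.map (Motives.sliceAt X t) k (complexBetti.map (fst X C) k c) = c := by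
  rw [← CategoryTheory.comp_apply, ← complexBetti.map_comp, Motives.sliceAt_fst,
    complexBetti.map_id]
  rfl

/-- **The Hodge conjecture descends along `pr_X : X × C → X`** (`C` a smooth projective curve with
infinitely many complex points, e.g. `ℙ¹`). Granted the tree's named fact
`hodgePQ_independent_of_hodgeModel` (pull-backs along `pr_X` preserve Hodge types,
`IsOfHodgeType.map_of_independent`) and a Hodge model of `X`: if `HodgeConjectureFor (n + 1) (X ⊗ C)`
then `HodgeConjectureFor n X`. For a rational `(p, p)`-class `c` on `X`, `pr_X^* c` is rational and
of type `(p, p)`, hence algebraic on `X ⊗ C`; a general slice `i_t^*(pr_X^* c) = c` is then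
algebraic (`exists_sliceAt_map_mem_algebraicClasses`). In print: `HC(X × ℙ¹) ⇒ HC(X)` by
`i_t^* ∘ pr_X^* = id` and functoriality of cycle classes. [cite: Fulton1998, §10.1, Example 10.1.2]
[cite: VoisinHodgeI2002, §7.3.2 and §11.3] -/
theorem hodgeConjectureFor_of_tensor (hI : hodgePQ_independent_of_hodgeModel)
    (hX : IsSmoothProjective n X) (hC : IsSmoothProjective 1 C) [Infinite (ComplexPoints C)]
    (hM : Nonempty (HodgeModel n X)) (h : HodgeConjectureFor (n + 1) (X ⊗ C)) :
    HodgeConjectureFor n X := by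
  obtain ⟨⟨B⟩, hcyc⟩ := h
  have hXC : IsSmoothProjective (n + 1) (X ⊗ C) := Motives.IsSmoothProjective.tensor_holds hX hC
  refine ⟨hM, fun p c hc hpp ↦ ?_⟩
  have hc' : IsRationalClass (complexBetti.map (fst X C) (2 * p) c) := hc.map _
  have hpp' : IsOfHodgeType (n + 1) (X ⊗ C) (2 * p) p p (complexBetti.map (fst X C) (2 * p) c) :=
    hpp.map_of_independent hI hXC hX B (fst X C)
  have halg := hcyc p _ hc' hpp'
  obtain ⟨t, ht⟩ := exists_sliceAt_map_mem_algebraicClasses hX hC (exists_pt_notMem hC) halg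
  rwa [complexBetti_map_sliceAt_map_fst] at ht

/-- **Twice**: `HodgeConjectureFor (n + 2) ((X ⊗ C) ⊗ C) → HodgeConjectureFor n X`, granted
`hodgePQ_independent_of_hodgeModel` and Hodge models of `X` and `X ⊗ C`.
[cite: Fulton1998, §10.1, Example 10.1.2] [cite: VoisinHodgeI2002, §7.3.2 and §11.3] -/
theorem hodgeConjectureFor_of_tensor_tensor (hI : hodgePQ_independent_of_hodgeModel)
    (hX : IsSmoothProjective n X) (hC : IsSmoothProjective 1 C) [Infinite (ComplexPoints C)]
    (hM : Nonempty (HodgeModel n X)) (hM' : Nonempty (HodgeModel (n + 1) (X ⊗ C)))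
    (h : HodgeConjectureFor (n + 2) ((X ⊗ C) ⊗ C)) : HodgeConjectureFor n X :=
  hodgeConjectureFor_of_tensor hI hX hC hM
    (hodgeConjectureFor_of_tensor hI (Motives.IsSmoothProjective.tensor_holds hX hC) hC hM' h)

end Descent

end Summit.HodgeConjecture.HodgeConjecture.Theorems.HodgeBeyondAnchors

end
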